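import Mathlib
import Summits.ResolutionOfSingularities.ResolutionOfSingularities.Theorems.HomologicalConductorNoZenoSplitData
import Literature.AlgebraicGeometry.Resolution.Lipman1969FormallySmoothBaseChange
import HarnessLib

/-!
# D2′ PART 3b: the upstairs thread data at the thread germ `T_P` — `exists_splitData`

W4.4 (crux `NoZenoR`, stmt-ResolutionOfSingularities-19943), `stub_L1wCore` route (F1), descent
step (B2) of `L1W-PREP-v2.md` §2.1 (res-L0-w44-stub-2), continued from `…NoZenoSplitData` (the
upstairs model / prime / germ `splitModel D f`, `splitPrime D f`, `locPrime (D[β]) (𝔪_D·D[β])` and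
their local-étale bundle for any local `k`-subalgebra `D ⊆ K`).  Here `D` is specialised to the
THREAD GERM `locPrimeSubalgebra T P` of `Sig.L1Core` (res-L0-w44-lead-1): the `k`-subalgebra of
`K` with the same elements as `locPrime T P`.

* the two spellings of the germ agree on the nose (`locPrimeSubalgebraRingEquiv`,
  `ringKrullDim_locPrimeSubalgebra`, `isRegularLocalRing_locPrimeSubalgebra_iff` — by `rfl`);
* the germ inherits the model's binders: `Frac = K`, essentially of finite type, Noetherian, normal
  (`isFractionRing_` / `essFiniteType_` / `isNoetherianRing_` / `isIntegrallyClosed_locPrimeSubalgebra`,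
  instances; `isLocalization_locPrimeSubalgebra`);
* `P_f` lies over `P` (`toSplitModel_inclusion_mem_splitPrime_iff`);
* the `𝔪`-primary binder of `Sig.L1Core` transfers upstairs in its literal shape
  (`radical_span_image_eq`, via res-L0-w44-stub-2's `radical_map_eq_maximalIdeal_of_map_maximalIdeal_eq`);
* the named facts `Lipman1969_16_5` / `Lipman1969_16_1_ii` (as HYPOTHESES `h16_5`, `h16_1`, never
  discharged here) consume the bundle: rationality ascends to `D_f` (`hasRationalSingularity_germ`,
  `hasRationalSingularity_splitGerm` in `Sig.L1Core`'s spelling) and desingularisations pull back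
  (`isResolution_pullback_germ`);
* the packaging **`exists_splitData`** (one existential, as asked by res-L0-w44-plan-1 (ρ37f)): model
  `T_f`, prime `P_f`, base-change map `φ : T_P → D_f` and `E : T_P[X]/(f) ≃+* D_f` with all ring-level
  binders of `Sig.L1Core` upstairs and the local-étale clauses.

The chart side of `Sig.L1Core` (`B`, `nrm B`, `𝔮`, `D'`) is D2′ part 4 (not here).  OURS (cell
res-hironaka, chain W4.4); AI-written, weaker than expert review; nothing here is a statement of the
manuscript under review (Hironaka 2017); no Theses file is imported.
-/

noncomputable section

set_option linter.dupNamespace false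

open IsLocalRing Polynomial
open Summit.ResolutionOfSingularities.ResolutionOfSingularities.Theorems.NoZeno.SandwichCluster
open Parasite (locPrime isLocalRing_locPrime)
open Thread (toSubring_le_locPrime)

namespace Summit.ResolutionOfSingularities.ResolutionOfSingularities.Theorems.NoZeno.SplittingBase

variable {k K : Type} [Field k] [Field K] [Algebra k K]

/-! ## Specialisation to the thread germ `D = T_P` (`locPrimeSubalgebra T P`) -/

section Thread

open Parasite (mem_locPrime_of_mem inv_mem_locPrime_of_not_mem)
open Thread (isLocalization_locPrime isIntegrallyClosed_locPrime)

variable (T : Subalgebra k K) (P : Ideal ↥T) (hP : P.IsPrime)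

/-- `locPrimeSubalgebra T P` and `locPrime T P` have the same elements: the identity is a ring
isomorphism (for transporting hypotheses of `Sig.L1Core` stated on `locPrime T P`). [this work] -/
def locPrimeSubalgebraRingEquiv : ↥(locPrimeSubalgebra T P hP) ≃+* ↥(locPrime T P hP) :=
  RingEquiv.subringCongr (locPrimeSubalgebra_toSubring T P hP)

/-- The identity isomorphism does nothing on elements. [this work] -/
@[simp] theorem coe_locPrimeSubalgebraRingEquiv (d : ↥(locPrimeSubalgebra T P hP)) :
    ((locPrimeSubalgebraRingEquiv T P hP d : ↥(locPrime T P hP)) : K) = (d : K) := rfl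

/-- `dim` is literally the same number for the two spellings of the germ. [this work] -/
theorem ringKrullDim_locPrimeSubalgebra :
    ringKrullDim ↥(locPrimeSubalgebra T P hP) = ringKrullDim ↥(locPrime T P hP) := rfl

/-- Regularity is literally the same statement for the two spellings of the germ. [this work] -/
theorem isRegularLocalRing_locPrimeSubalgebra_iff :
    IsRegularLocalRing ↥(locPrimeSubalgebra T P hP) ↔ IsRegularLocalRing ↥(locPrime T P hP) := Iff.rfl

/-- `Frac (T_P) = K` when `Frac T = K`. [this work] -/
instance isFractionRing_locPrimeSubalgebra [IsFractionRing ↥T K] :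
    IsFractionRing ↥(locPrimeSubalgebra T P hP) K := by
  refine IsFractionRing.of_field _ K fun z => ?_
  obtain ⟨a, b, -, hz⟩ := IsFractionRing.div_surjective (A := ↥T) z
  exact ⟨⟨a, le_locPrimeSubalgebra T P hP a.2⟩, ⟨b, le_locPrimeSubalgebra T P hP b.2⟩, hz.symm⟩

/-- `T_P` is a localisation of `T` at `P` (BRIDGE `Thread.isLocalization_locPrime`, same carrier).
[this work] -/
theorem isLocalization_locPrimeSubalgebra :
    @IsLocalization.AtPrime ↥T _ ↥(locPrimeSubalgebra T P hP) _
      (Subalgebra.inclusion (le_locPrimeSubalgebra T P hP)).toRingHom.toAlgebra P hP :=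
  isLocalization_locPrime T P hP

/-- `T_P` is essentially of finite type over `k` when `T` is. [this work] -/
instance essFiniteType_locPrimeSubalgebra [Algebra.EssFiniteType k ↥T] :
    Algebra.EssFiniteType k ↥(locPrimeSubalgebra T P hP) := by
  letI : Algebra ↥T ↥(locPrimeSubalgebra T P hP) :=
    (Subalgebra.inclusion (le_locPrimeSubalgebra T P hP)).toRingHom.toAlgebra
  haveI := isLocalization_locPrimeSubalgebra T P hP
  haveI : IsScalarTower k ↥T ↥(locPrimeSubalgebra T P hP) := IsScalarTower.of_algebraMap_eq fun _ => rfl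
  haveI : Algebra.EssFiniteType ↥T ↥(locPrimeSubalgebra T P hP) :=
    Algebra.EssFiniteType.of_isLocalization _ P.primeCompl
  exact Algebra.EssFiniteType.comp k ↥T _

/-- `T_P` is Noetherian when `T` is. [this work] -/
instance isNoetherianRing_locPrimeSubalgebra [IsNoetherianRing ↥T] :
    IsNoetherianRing ↥(locPrimeSubalgebra T P hP) := by
  letI : Algebra ↥T ↥(locPrimeSubalgebra T P hP) :=
    (Subalgebra.inclusion (le_locPrimeSubalgebra T P hP)).toRingHom.toAlgebra
  haveI := isLocalization_locPrimeSubalgebra T P hP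
  exact IsLocalization.isNoetherianRing P.primeCompl _ inferInstance

/-- `T_P` is a normal domain when `T` is. [this work] -/
instance isIntegrallyClosed_locPrimeSubalgebra [IsIntegrallyClosed ↥T] :
    IsIntegrallyClosed ↥(locPrimeSubalgebra T P hP) :=
  isIntegrallyClosed_locPrime T P hP

/-- An element of `T` lies in `𝔪_(T_P)` iff it lies in `P`. [this work] -/
theorem inclusion_mem_maximalIdeal_iff (t : ↥T) :
    Subalgebra.inclusion (le_locPrimeSubalgebra T P hP) t ∈ maximalIdeal ↥(locPrimeSubalgebra T P hP) ↔
      t ∈ P := by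
  rw [mem_maximalIdeal, mem_nonunits_iff]
  constructor
  · intro hnu
    by_contra htP
    have ht0 : (t : K) ≠ 0 := Parasite.ne_zero_of_not_mem_ideal T P t.2 (by simpa using htP)
    have hinv : (t : K)⁻¹ ∈ locPrime T P hP := inv_mem_locPrime_of_not_mem T P hP t.2 (by simpa using htP)
    exact hnu ⟨⟨_, ⟨(t : K)⁻¹, hinv⟩, Subtype.ext (mul_inv_cancel₀ ht0),
      Subtype.ext (inv_mul_cancel₀ ht0)⟩, rfl⟩
  · intro htP hunit
    by_cases ht0 : (t : K) = 0
    · have : (Subalgebra.inclusion (le_locPrimeSubalgebra T P hP) t) = 0 := Subtype.ext ht0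
      rw [this, isUnit_zero_iff] at hunit
      exact zero_ne_one hunit
    · obtain ⟨v, hv⟩ := hunit.exists_right_inv
      have hvK : (v : K) = (t : K)⁻¹ :=
        eq_inv_of_mul_eq_one_right (congrArg (fun z : ↥(locPrimeSubalgebra T P hP) => (z : K)) hv)
      exact Parasite.inv_not_mem_locPrime_of_mem T P hP t.2 (by simpa using htP) ht0 (hvK ▸ v.2)

variable (f : (↥(locPrimeSubalgebra T P hP))[X])

/-- **`P_f` lies over `P`.** [this work] -/
theorem toSplitModel_inclusion_mem_splitPrime_iff (hf : f.Monic)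
    (hirr : Irreducible (f.map (residue ↥(locPrimeSubalgebra T P hP)))) (t : ↥T) :
    toSplitModel (locPrimeSubalgebra T P hP) f (Subalgebra.inclusion (le_locPrimeSubalgebra T P hP) t) ∈
      splitPrime (locPrimeSubalgebra T P hP) f ↔ t ∈ P := by
  rw [toSplitModel_mem_splitPrime_iff _ f hf hirr, inclusion_mem_maximalIdeal_iff]

variable [Fact (Irreducible (f.map (algebraMap ↥(locPrimeSubalgebra T P hP) K)))]

/-- **The `𝔪`-primary binder of `Sig.L1Core` transfers upstairs**, in its literal shape: for
`C ⊆ T_P` with `√((C)·T_P) = 𝔪`, upstairs `√((C)·D_f) = 𝔪_(D_f)` for the image of `C` in `K_f`.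
[this work] -/
theorem radical_span_image_eq (hf : f.Monic)
    (hirr : Irreducible (f.map (residue ↥(locPrimeSubalgebra T P hP))))
    (hPf : (splitPrime (locPrimeSubalgebra T P hP) f).IsPrime) [IsNoetherianRing ↥T]
    (C : Set K) (hC : C ⊆ locPrime T P hP)
    (hrad : (Ideal.span {d : ↥(locPrime T P hP) | (d : K) ∈ C}).radical =
      @maximalIdeal ↥(locPrime T P hP) _ (isLocalRing_locPrime T P hP)) :
    (Ideal.span {d : ↥(locPrime (splitModel (locPrimeSubalgebra T P hP) f)
        (splitPrime (locPrimeSubalgebra T P hP) f) hPf) |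
        (d : AdjoinRoot (f.map (algebraMap ↥(locPrimeSubalgebra T P hP) K))) ∈
          algebraMap K (AdjoinRoot (f.map (algebraMap ↥(locPrimeSubalgebra T P hP) K))) '' C}).radical =
      @maximalIdeal _ _ (isLocalRing_locPrime _ _ hPf) := by
  set φ := algebraMap ↥(locPrimeSubalgebra T P hP)
    ↥(locPrime (splitModel (locPrimeSubalgebra T P hP) f) (splitPrime (locPrimeSubalgebra T P hP) f) hPf)
    with hφ
  have hrad' : (Ideal.span {d : ↥(locPrimeSubalgebra T P hP) | (d : K) ∈ C}).radical =
      maximalIdeal ↥(locPrimeSubalgebra T P hP) := hrad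
  have hset : {d : ↥(locPrime (splitModel (locPrimeSubalgebra T P hP) f)
        (splitPrime (locPrimeSubalgebra T P hP) f) hPf) |
        (d : AdjoinRoot (f.map (algebraMap ↥(locPrimeSubalgebra T P hP) K))) ∈
          algebraMap K (AdjoinRoot (f.map (algebraMap ↥(locPrimeSubalgebra T P hP) K))) '' C} =
      φ '' {d : ↥(locPrimeSubalgebra T P hP) | (d : K) ∈ C} := by
    ext d
    constructor
    · rintro ⟨c, hc, hcd⟩
      exact ⟨⟨c, hC hc⟩, hc, Subtype.ext (by rw [hφ, coe_algebraMap_germ]; exact hcd)⟩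
    · rintro ⟨d₀, hd₀, rfl⟩
      exact ⟨(d₀ : K), hd₀, (coe_algebraMap_germ _ f hPf d₀).symm⟩
  rw [hset, ← Ideal.map_span]
  exact radical_map_eq_maximalIdeal_of_map_maximalIdeal_eq φ (map_maximalIdeal_germ _ f hf hirr hPf) hrad'

/-- **D2′ PART 3 — `exists_splitData` (packaging, res-L0-w44-plan-1 (ρ37f)).**  For the thread germ
`D = T_P` of a normal model `T` essentially of finite type with `Frac T = K`, and a monic `f ∈ D[X]`
with irreducible separable reduction modulo `𝔪_D`: there are an upstairs model `T_f ⊆ K_f`, a prime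
`P_f`, the base-change map `φ : D → D_f := locPrime T_f P_f` and `E : D[X]/(f) ≃+* D_f` with all the
ring-level binders of `Sig.L1Core` upstairs and the local-étale clauses (the named-fact hypotheses of
`Lipman1969_16_1_ii` / `Lipman1969_16_5`); the witnesses are `splitModel`, `splitPrime`, `algebraMap`
(`germAlgebra`), `splitGermEquiv`, whose finer API (residue field, flatness, étaleness as instances)
is above. [this work] -/
theorem exists_splitData [Algebra.EssFiniteType k ↥T] [IsIntegrallyClosed ↥T] [IsFractionRing ↥T K]
    (hf : f.Monic) (hirr : Irreducible (f.map (residue ↥(locPrimeSubalgebra T P hP))))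
    (hsep : (f.map (residue ↥(locPrimeSubalgebra T P hP))).Separable) :
    ∃ (Tf : Subalgebra k (AdjoinRoot (f.map (algebraMap ↥(locPrimeSubalgebra T P hP) K))))
      (Pf : Ideal ↥Tf) (hPf : Pf.IsPrime)
      (φ : ↥(locPrimeSubalgebra T P hP) →+* ↥(locPrime Tf Pf hPf))
      (E : AdjoinRoot f ≃+* ↥(locPrime Tf Pf hPf)),
      Algebra.EssFiniteType k ↥Tf ∧ IsIntegrallyClosed ↥Tf ∧
      IsFractionRing ↥Tf (AdjoinRoot (f.map (algebraMap ↥(locPrimeSubalgebra T P hP) K))) ∧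
      (∀ x ∈ locPrime T P hP, algebraMap K _ x ∈ Tf) ∧
      AdjoinRoot.root (f.map (algebraMap ↥(locPrimeSubalgebra T P hP) K)) ∈ Tf ∧
      (∀ d, ((φ d : ↥(locPrime Tf Pf hPf)) : AdjoinRoot (f.map (algebraMap _ K))) =
        algebraMap K _ (d : K)) ∧
      (∀ d, E (AdjoinRoot.of f d) = φ d) ∧
      ((E (AdjoinRoot.root f) : ↥(locPrime Tf Pf hPf)) : AdjoinRoot (f.map (algebraMap _ K))) =
        AdjoinRoot.root _ ∧
      IsLocalHom φ ∧
      (maximalIdeal ↥(locPrimeSubalgebra T P hP)).map φ = maximalIdeal ↥(locPrime Tf Pf hPf) ∧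
      φ.Flat ∧ φ.Finite ∧ IsNoetherianRing ↥(locPrime Tf Pf hPf) ∧
      IsIntegrallyClosed ↥(locPrime Tf Pf hPf) ∧
      ringKrullDim ↥(locPrime Tf Pf hPf) = ringKrullDim ↥(locPrime T P hP) ∧
      (IsRegularLocalRing ↥(locPrime Tf Pf hPf) ↔ IsRegularLocalRing ↥(locPrime T P hP)) := by
  haveI : IsNoetherianRing ↥T := Algebra.EssFiniteType.isNoetherianRing k ↥T
  have hPf := isPrime_splitPrime (locPrimeSubalgebra T P hP) f hf hirr
  refine ⟨splitModel _ f, splitPrime _ f, hPf, algebraMap _ _,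
    splitGermEquiv (locPrimeSubalgebra T P hP) f hf hirr hPf, essFiniteType_splitModel _ f hf,
    isIntegrallyClosed_splitModel _ f hf hirr hsep, isFractionRing_splitModel _ f hf,
    fun x hx => algebraMap_mem_splitModel _ f hx, root_mem_splitModel _ f,
    coe_algebraMap_germ _ f hPf, fun d => ?_, ?_, isLocalHom_germ _ f hf hirr hPf,
    map_maximalIdeal_germ _ f hf hirr hPf, ?_, ?_, isNoetherianRing_germ _ f hf hirr hPf,
    isIntegrallyClosed_germ _ f hf hirr hsep hPf,
    (ringKrullDim_germ _ f hf hirr hsep hPf).trans (ringKrullDim_locPrimeSubalgebra T P hP),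
    (isRegularLocalRing_germ_iff _ f hf hirr hsep hPf).trans
      (isRegularLocalRing_locPrimeSubalgebra_iff T P hP)⟩
  · rw [← AdjoinRoot.algebraMap_eq, ← splitGermAlgEquiv_apply]
    exact (splitGermAlgEquiv _ f hf hirr hPf).commutes d
  · rw [coe_splitGermEquiv, modelHom_root]
  · exact RingHom.flat_algebraMap_iff.mpr (flat_germ _ f hf hirr hPf)
  · exact RingHom.finite_algebraMap.mpr (finite_germ _ f hf hirr hPf)

/-! ### Consuming the named facts: rationality ascends, desingularisations pull back

The local-étale bundle above is exactly the hypothesis list of the NAMED FACTS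
`Literature.AlgebraicGeometry.Resolution.Lipman1969_16_1_ii` / `Lipman1969_16_5` (kept as explicit
hypotheses `h16_1`, `h16_5`, never discharged here). -/

open Literature.AlgebraicGeometry.Resolution CategoryTheory AlgebraicGeometry in
/-- **Rationality ascends to the upstairs germ** (Lipman (16.5) as a hypothesis): if `D` is a normal
Noetherian local `k`-subalgebra of `K` of dimension two with a rational singularity, so is `D_f`.
[this work; conditional on the named fact `Lipman1969_16_5`] -/
theorem hasRationalSingularity_germ (h16_5 : Lipman1969_16_5.{0}) (D : Subalgebra k K) [IsLocalRing ↥D]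
    [IsNoetherianRing ↥D] [IsIntegrallyClosed ↥D] (f : (↥D)[X])
    [Fact (Irreducible (f.map (algebraMap ↥D K)))] (hf : f.Monic)
    (hirr : Irreducible (f.map (residue ↥D))) (hsep : (f.map (residue ↥D)).Separable)
    (hPf : (splitPrime D f).IsPrime) (hdim : ringKrullDim ↥D = 2) (hrat : HasRationalSingularity ↥D) :
    HasRationalSingularity ↥(locPrime (splitModel D f) (splitPrime D f) hPf) := by
  haveI := isLocalHom_germ D f hf hirr hPf
  haveI := flat_germ D f hf hirr hPf
  haveI := isNoetherianRing_germ D f hf hirr hPf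
  have hsepκ := isSeparable_residueField_germ D f hf hirr hsep hPf
  obtain ⟨X, g, hg, hH⟩ := hrat
  have hdim' : ringKrullDim ↥(locPrime (splitModel D f) (splitPrime D f) hPf) = 2 :=
    (ringKrullDim_germ D f hf hirr hsep hPf).trans hdim
  obtain ⟨-, hiff⟩ := h16_5 ↥D ↥(locPrime (splitModel D f) (splitPrime D f) hPf) inferInstance
    (map_maximalIdeal_germ D f hf hirr hPf) hsepκ hdim hdim' ⟨X, g, hg⟩
  exact (hiff ⟨inferInstance, inferInstance⟩).mp ⟨X, g, hg, hH⟩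

open Literature.AlgebraicGeometry.Resolution CategoryTheory AlgebraicGeometry in
/-- **Desingularisations pull back to the upstairs germ** (Lipman (16.1)(ii) as a hypothesis).
[this work; conditional on the named fact `Lipman1969_16_1_ii`] -/
theorem isResolution_pullback_germ (h16_1 : Lipman1969_16_1_ii.{0}) (D : Subalgebra k K)
    [IsLocalRing ↥D] [IsNoetherianRing ↥D] (f : (↥D)[X]) [Fact (Irreducible (f.map (algebraMap ↥D K)))]
    (hf : f.Monic) (hirr : Irreducible (f.map (residue ↥D))) (hsep : (f.map (residue ↥D)).Separable)
    (hPf : (splitPrime D f).IsPrime) {Y : Scheme.{0}} (g : Y ⟶ Spec (.of ↥D)) (hg : IsResolution g) :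
    IsResolution (Limits.pullback.snd g (Spec.map (CommRingCat.ofHom
      (algebraMap ↥D ↥(locPrime (splitModel D f) (splitPrime D f) hPf))))) := by
  haveI := isLocalHom_germ D f hf hirr hPf
  haveI := flat_germ D f hf hirr hPf
  haveI := isNoetherianRing_germ D f hf hirr hPf
  exact (h16_1 ↥D ↥(locPrime (splitModel D f) (splitPrime D f) hPf) inferInstance
    (map_maximalIdeal_germ D f hf hirr hPf) (isSeparable_residueField_germ D f hf hirr hsep hPf) Y g hg).2

/-- **Rationality of the upstairs thread germ** in `Sig.L1Core`'s spelling (`locPrime T P`).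
[this work; conditional on the named fact `Lipman1969_16_5`] -/
theorem hasRationalSingularity_splitGerm
    (h16_5 : Literature.AlgebraicGeometry.Resolution.Lipman1969_16_5.{0})
    [Algebra.EssFiniteType k ↥T] [IsIntegrallyClosed ↥T] (hf : f.Monic)
    (hirr : Irreducible (f.map (residue ↥(locPrimeSubalgebra T P hP))))
    (hsep : (f.map (residue ↥(locPrimeSubalgebra T P hP))).Separable)
    (hPf : (splitPrime (locPrimeSubalgebra T P hP) f).IsPrime)
    (hdim : ringKrullDim ↥(locPrime T P hP) = 2)
    (hrat : Literature.AlgebraicGeometry.Resolution.HasRationalSingularity ↥(locPrime T P hP)) :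
    Literature.AlgebraicGeometry.Resolution.HasRationalSingularity
      ↥(locPrime (splitModel (locPrimeSubalgebra T P hP) f) (splitPrime (locPrimeSubalgebra T P hP) f) hPf) := by
  haveI : IsNoetherianRing ↥T := Algebra.EssFiniteType.isNoetherianRing k ↥T
  exact hasRationalSingularity_germ h16_5 _ f hf hirr hsep hPf hdim hrat

end Thread

end Summit.ResolutionOfSingularities.ResolutionOfSingularities.Theorems.NoZeno.SplittingBase

end
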